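import Summits.CriticalPhenomena.CardyFormulaZ2.Theorems.CardyQContinuationIsingJetsConformalStubSandwichUpper
import Summits.CriticalPhenomena.CardyFormulaZ2.Theorems.CardyQContinuationIsingJetsConformalStubPathUpper
import Literature.Probability.LatticeModels.FKIsingQuadrilateralCrossing
import Literature.Probability.LatticeModels.RandomClusterEmbedding

/-!
# Crux `IsingJetsConformal`, stub `stub_loopSymmetricLimit_upperComparison`:
# the upper comparison `φ^{W₀ ∪ W₂}_{Ω_δ}(W₀ ↔ W₂) ≤ φ^{B₀ ∪ B₂}_{⟨E⟩}(B₀ ↔ B₂)`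
# of the `n = 0` bridge
# (route `CardyQContinuation`, item stmt-CriticalPhenomena-5560)

The discretisation `Ω_δ` of a conformal rectangle `R` (vertices `meshDomain R.carrier δ`, graph
`discreteDomainGraph R.carrier δ`, wired discrete arcs `W₀ = discreteArc R.carrier δ (R.arc 0)`,
`W₂ = discreteArc R.carrier δ (R.arc 2)`) and a glued discrete quadrilateral (edge set `E`, vertex
set `verts E`, black vertex sets `B₀ = blackVerts E d₀ n 0`, `B₂`) live in `ℤ²`; a wired zone
`Z₀ ⊔ Z₂ ⊇ W₀ ∪ B₀, W₂ ∪ B₂` is given such that no edge of `Ω_δ` or `E` joins `Z₀` to `Z₂`, the zone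
vertices of the quadrilateral are black, every vertex of `Ω_δ ∪ verts E` off the zone is a non-black
quadrilateral vertex, and every `Ω_δ`-edge missing from `E` has its endpoints in the zone. Then the
`fkDomainMeasure`-probability of Smirnov's crossing event `W₀ ↔ W₂` is at most the
`φ^{B₀ ∪ B₂}_{⟨E⟩}`-probability of `B₀ ↔ B₂`.

Proof. Both graphs are embedded in the common finite vertex type
`V = ↥(meshDomain R.carrier δ ∪ verts E)`; along an injection of vertex types the random-cluster
measure of corresponding events is unchanged (`rcMeasure_real_map_image`, idle vertices unwired;
`rcMeasure_real_map_of_wired`, idle vertices wired — Grimmett 2006, Lemma (4.13)), and crossing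
events correspond (`UpperComparison.arcCrossing_image_iff`). Inside `V` the landed stub
`stub_loopSymmetricLimit_sandwichUpper` (domain/wired-set monotonicity and the domain Markov
property, Grimmett 2006, Thm. (3.1)(a), Lemmas 4.13, (4.14)) compares `φ^{W}_{⟨EΩ⟩}(W₀ ↔ W₂)` with
`φ^{Z}_{⟨EQ⟩}(B₀ ↔ B₂)`, its deterministic hypothesis being the landed path lemma
`stub_loopSymmetricLimit_pathUpper`: an open `W₀`–`W₂` path contains an open `EQ`-path between zone
vertices incident to `E`-edges, which are black, hence in `B₀`, resp. `B₂`.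

References: G. Grimmett, *The Random-Cluster Model*, Springer (2006), §1.2, §4.2, Lemma (4.13);
S. Smirnov, C. R. Acad. Sci. 333 (2001), §2 (the crossing event); D. Chelkak, S. Smirnov,
Invent. Math. 189 (2012), §6 (the quadrilateral). No new definitions.
-/

namespace Summit.CriticalPhenomena.CardyFormulaZ2.Theorems.CardyQContinuation

open MeasureTheory SimpleGraph
open Literature.Probability.LatticeModels
open Literature.Probability.Percolation
open Literature.Probability.RandomPlanarGeometry

noncomputable section

namespace UpperComparison

/-! #### Transport of crossing events along an injection of vertex types -/

section Transport

variable {V U : Type*} (j : V ↪ U)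

/-- Crossing events correspond along an injection `j` of vertex types: the image configuration
`j(ω)` joins `j(B₁)` to `j(B₂)` iff `ω` joins `B₁` to `B₂` (open paths of `j(ω)` starting in the
range of `j` stay in it). [folklore] -/
theorem arcCrossing_image_iff (ω : Set (Sym2 V)) (B₁ B₂ : Set V) :
    Sym2.map j '' ω ∈ arcCrossing (j '' B₁) (j '' B₂) ↔ ω ∈ arcCrossing B₁ B₂ := by
  have key : ∀ a b : V, (openGraph (Sym2.map j '' ω)).Reachable (j a) (j b) ↔
      (openGraph ω).Reachable a b := fun a b => by
    unfold openGraph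
    rw [fromEdgeSet_image_eq_map]
    refine ⟨fun h => ?_, reachable_map_of_reachable j _⟩
    obtain ⟨y, hy, hr⟩ := exists_of_reachable_map j _ h
    rw [j.injective hy]
    exact hr
  constructor
  · rintro ⟨_, ⟨a, ha, rfl⟩, _, ⟨b, hb, rfl⟩, h⟩
    exact ⟨a, ha, b, hb, (key a b).1 h⟩
  · rintro ⟨a, ha, b, hb, h⟩
    exact ⟨j a, ⟨a, ha, rfl⟩, j b, ⟨b, hb, rfl⟩, (key a b).2 h⟩

/-- `SimpleGraph.mem_edgeFinset` with the `Fintype` instance a unifiable implicit argument: the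
edge finsets handed over by the landed stubs carry the generic instance `fintypeEdgeSet`, whereas
instance synthesis on a graph `fromEdgeSet ↑F` finds Mathlib's dedicated instance. [folklore] -/
theorem mem_edgeFinset_iff {G : SimpleGraph V} {hG : Fintype G.edgeSet} {e : Sym2 V} :
    e ∈ @edgeFinset V G hG ↔ e ∈ G.edgeSet :=
  @mem_edgeFinset V G e hG

variable [Fintype V] (K : SimpleGraph V) [DecidableRel K.Adj]

/-- The image of an edge set under `j` has no loops. [folklore] -/
theorem not_isDiag_of_mem_map {e : Sym2 U} (he : e ∈ K.edgeFinset.map j.sym2Map) : ¬ e.IsDiag := by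
  obtain ⟨e₀, he₀, rfl⟩ := Finset.mem_map.1 he
  rw [Function.Embedding.sym2Map_apply, Sym2.isDiag_map j.injective]
  exact not_isDiag_of_mem_edgeFinset he₀

/-- The image of the edge set of `K` is the edge set of the spanning graph it generates.
[folklore] -/
theorem edgeSet_fromEdgeSet_map :
    (fromEdgeSet (↑(K.edgeFinset.map j.sym2Map) : Set (Sym2 U))).edgeSet =
      ↑(K.edgeFinset.map j.sym2Map) := by
  ext e
  rw [edgeSet_fromEdgeSet]
  exact ⟨fun h => h.1, fun h => ⟨h, not_isDiag_of_mem_map j K h⟩⟩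

/-- The edge finset of the spanning graph `⟨j E(K)⟩` (for any `Fintype` instance) is `j E(K)`.
[folklore] -/
theorem edgeFinset_fromEdgeSet_map
    {hG : Fintype (fromEdgeSet (↑(K.edgeFinset.map j.sym2Map) : Set (Sym2 U))).edgeSet} :
    @edgeFinset U _ hG = K.edgeFinset.map j.sym2Map :=
  Finset.ext fun e => mem_edgeFinset_iff.trans (by rw [edgeSet_fromEdgeSet_map, Finset.mem_coe])

/-- Endpoints of image edges lie in the range of `j`. [folklore] -/
theorem exists_apply_eq_of_mem_map {e : Sym2 U} (he : e ∈ K.edgeFinset.map j.sym2Map) {u : U}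
    (hu : u ∈ e) : ∃ a, j a = u := by
  obtain ⟨e₀, -, rfl⟩ := Finset.mem_map.1 he
  rw [Function.Embedding.sym2Map_apply, Sym2.mem_map] at hu
  obtain ⟨a, -, ha⟩ := hu
  exact ⟨a, ha⟩

variable [Fintype U] [DecidableEq U]

/-- A pair `{u, w}` is an image edge iff it is the image of an edge of `K`. [folklore] -/
theorem mk_mem_map_iff {u w : U} :
    s(u, w) ∈ K.edgeFinset.map j.sym2Map ↔ ∃ a b, K.Adj a b ∧ j a = u ∧ j b = w := by
  rw [← edgeFinset_map, mem_edgeFinset, mem_edgeSet, SimpleGraph.map_adj]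

variable [DecidableEq V] {K}

/-- **Transport of a crossing probability, idle vertices unwired**: the random-cluster measure of
the spanning graph `⟨j E(K)⟩` on `U`, wired on `j(W)`, gives the crossing `j(B₁) ↔ j(B₂)` the
`φ^W_{K,p,q}`-probability of `B₁ ↔ B₂`. [cite: Grimmett2006, Lemma (4.13)] -/
theorem rcMeasure_real_arcCrossing_map_image
    [DecidableRel (fromEdgeSet (↑(K.edgeFinset.map j.sym2Map) : Set (Sym2 U))).Adj]
    {p q : ℝ} (hp : p ∈ Set.Icc (0 : ℝ) 1) (hq : 0 < q) (W B₁ B₂ : Set V) :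
    (rcMeasure (fromEdgeSet (↑(K.edgeFinset.map j.sym2Map) : Set (Sym2 U))) p q (j '' W)).real
        (arcCrossing (j '' B₁) (j '' B₂)) = (rcMeasure K p q W).real (arcCrossing B₁ B₂) :=
  rcMeasure_real_map_image j (edgeFinset_fromEdgeSet_map j K) hp hq W fun ω _ => by
    rw [coe_map_sym2Map, arcCrossing_image_iff]

/-- **Transport of a crossing probability, idle vertices wired**: if `W ≠ ∅` and `W'` consists of
`j(W)` and all vertices off the range of `j`, the random-cluster measure of `⟨j E(K)⟩` wired on
`W'` gives `j(B₁) ↔ j(B₂)` the `φ^W_{K,p,q}`-probability of `B₁ ↔ B₂`.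
[cite: Grimmett2006, Lemma (4.13)] -/
theorem rcMeasure_real_arcCrossing_map_of_wired
    [DecidableRel (fromEdgeSet (↑(K.edgeFinset.map j.sym2Map) : Set (Sym2 U))).Adj]
    {p q : ℝ} (hp : p ∈ Set.Icc (0 : ℝ) 1) (hq : 0 < q) {W : Set V} (hW : W.Nonempty)
    {W' : Set U} (hW' : ∀ u, u ∈ W' ↔ ∀ x, j x = u → x ∈ W) (B₁ B₂ : Set V) :
    (rcMeasure (fromEdgeSet (↑(K.edgeFinset.map j.sym2Map) : Set (Sym2 U))) p q W').real
        (arcCrossing (j '' B₁) (j '' B₂)) = (rcMeasure K p q W).real (arcCrossing B₁ B₂) :=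
  rcMeasure_real_map_of_wired j (edgeFinset_fromEdgeSet_map j K) hp hq hW hW' fun ω _ => by
    rw [coe_map_sym2Map, arcCrossing_image_iff]

end Transport

/-! #### The zone hypotheses inside a common vertex type -/

section Zone

variable {V : Type} [DecidableEq V] {α : Type*} (π : V → α) {EΩ EQ : Finset (Sym2 V)}
  {DΩ : α → α → Prop} {E : Finset (Sym2 α)} {Z₀ Z₂ : Set α}

/-- No edge of `⟨EΩ ∪ EQ⟩` joins the two blocks of the zone, if no `Ω_δ`-edge and no `E`-edge
does. [folklore] -/
theorem not_adj_of_mem_zone (hΩ : ∀ u w : V, s(u, w) ∈ EΩ → DΩ (π u) (π w))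
    (hQ : ∀ u w : V, s(u, w) ∈ EQ → s(π u, π w) ∈ E)
    (hfar : ∀ x ∈ Z₀, ∀ y ∈ Z₂, ¬ DΩ x y ∧ s(x, y) ∉ E) :
    ∀ x ∈ {v : V | π v ∈ Z₀}, ∀ y ∈ {v : V | π v ∈ Z₂},
      ¬ (fromEdgeSet (↑(EΩ ∪ EQ) : Set (Sym2 V))).Adj x y := by
  intro x hx y hy h
  rw [fromEdgeSet_adj, Finset.mem_coe, Finset.mem_union] at h
  rcases h.1 with h' | h'
  · exact (hfar _ hx _ hy).1 (hΩ x y h')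
  · exact (hfar _ hx _ hy).2 (hQ x y h')

/-- Every edge of `⟨EΩ ∪ EQ⟩` off `EQ` is an `Ω_δ`-edge missing from `E`, hence has both endpoints
in the zone. [folklore] -/
theorem mem_zone_of_mem_edgeSet (hΩ : ∀ u w : V, s(u, w) ∈ EΩ → DΩ (π u) (π w))
    (hsymm : ∀ x y, DΩ x y → DΩ y x)
    (hQ' : ∀ u w : V, DΩ (π u) (π w) → s(π u, π w) ∈ E → s(u, w) ∈ EQ)
    (hmiss : ∀ x y, DΩ x y → s(x, y) ∉ E → x ∈ Z₀ ∪ Z₂) :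
    ∀ e ∈ (fromEdgeSet (↑(EΩ ∪ EQ) : Set (Sym2 V))).edgeSet, e ∉ (↑EQ : Set (Sym2 V)) →
      ∀ x ∈ e, x ∈ {v : V | π v ∈ Z₀} ∪ {v : V | π v ∈ Z₂} := by
  intro e he heQ
  induction e using Sym2.ind with
  | h u w =>
    rw [mem_edgeSet, fromEdgeSet_adj, Finset.mem_coe, Finset.mem_union] at he
    rw [Finset.mem_coe] at heQ
    have hD : DΩ (π u) (π w) := hΩ u w (he.1.resolve_right heQ)
    have hE : s(π u, π w) ∉ E := fun h => heQ (hQ' u w hD h)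
    have hu : π u ∈ Z₀ ∪ Z₂ := hmiss _ _ hD hE
    have hw : π w ∈ Z₀ ∪ Z₂ := hmiss _ _ (hsymm _ _ hD) (by rwa [Sym2.eq_swap])
    intro x hx
    rcases Sym2.mem_iff.1 hx with rfl | rfl
    · exact hu
    · exact hw

/-- **The deterministic hypothesis of the upper sandwich.** If the `EΩ`-part of a configuration
`ω ⊆ E(⟨EΩ ∪ EQ⟩)` joins `A₁ ⊆ π⁻¹ Z₀` to `A₂ ⊆ π⁻¹ Z₂`, then its `EQ`-part joins `C₁` to `C₂`,
provided every zone vertex over `Z₀` (resp. `Z₂`) incident to an `EQ`-edge lies in `C₁` (resp.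
`C₂`): the path lemma `stub_loopSymmetricLimit_pathUpper`. [folklore] -/
theorem inter_mem_arcCrossing (hΩ : ∀ u w : V, s(u, w) ∈ EΩ → DΩ (π u) (π w))
    (hQ : ∀ u w : V, s(u, w) ∈ EQ → s(π u, π w) ∈ E) (hsymm : ∀ x y, DΩ x y → DΩ y x)
    (hQ' : ∀ u w : V, DΩ (π u) (π w) → s(π u, π w) ∈ E → s(u, w) ∈ EQ)
    (hfar : ∀ x ∈ Z₀, ∀ y ∈ Z₂, ¬ DΩ x y ∧ s(x, y) ∉ E)
    (hmiss : ∀ x y, DΩ x y → s(x, y) ∉ E → x ∈ Z₀ ∪ Z₂) (hdisj : Disjoint Z₀ Z₂)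
    {A₁ A₂ C₁ C₂ : Set V} (hA₁ : ∀ v ∈ A₁, π v ∈ Z₀) (hA₂ : ∀ v ∈ A₂, π v ∈ Z₂)
    (hC₁ : ∀ v, π v ∈ Z₀ → ∀ e ∈ EQ, v ∈ e → v ∈ C₁)
    (hC₂ : ∀ v, π v ∈ Z₂ → ∀ e ∈ EQ, v ∈ e → v ∈ C₂) (ω : BondConfig V)
    (hω : ω ⊆ (fromEdgeSet (↑(EΩ ∪ EQ) : Set (Sym2 V))).edgeSet)
    (h : ω ∩ ↑EΩ ∈ arcCrossing A₁ A₂) : ω ∩ ↑EQ ∈ arcCrossing C₁ C₂ := by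
  obtain ⟨a, ha, b, hb, hr⟩ := h
  have hdisj' : Disjoint {v : V | π v ∈ Z₀} {v : V | π v ∈ Z₂} :=
    Set.disjoint_left.2 fun v h₀ h₂ => Set.disjoint_left.1 hdisj h₀ h₂
  obtain ⟨x', hx', y', hy', ⟨e₁, he₁, hx'e⟩, ⟨e₂, he₂, hy'e⟩, hr'⟩ :=
    stub_loopSymmetricLimit_pathUpper V _ (↑EQ) {v : V | π v ∈ Z₀} {v : V | π v ∈ Z₂} ω hω
      (mem_zone_of_mem_edgeSet π hΩ hsymm hQ' hmiss) (not_adj_of_mem_zone π hΩ hQ hfar) hdisj'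
      a (hA₁ a ha) b (hA₂ b hb) (hr.mono (openGraph_mono Set.inter_subset_left))
  exact ⟨x', hC₁ x' hx' e₁ he₁.2 hx'e, y', hC₂ y' hy' e₂ he₂.2 hy'e, hr'⟩

/-- Zone vertices of the quadrilateral over `Z₀` are in `B₀` (they are black, and `B₂ ⊆ Z₂` is
disjoint from `Z₀`). [folklore] -/
theorem mem_black_of_mem_zone {B₀ B₂ : Set α} {Q : Set α} (hdisj : Disjoint Z₀ Z₂) (hB₂ : B₂ ⊆ Z₂)
    (hblack : ∀ v ∈ Z₀ ∪ Z₂, v ∈ Q → v ∈ B₀ ∪ B₂) {v : α} (hv : v ∈ Z₀) (hvQ : v ∈ Q) :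
    v ∈ B₀ :=
  (hblack v (Or.inl hv) hvQ).resolve_right fun h => Set.disjoint_left.1 hdisj hv (hB₂ h)

/-- **The wired set of the quadrilateral seen in the common vertex type.** In
`V = ↥(M ∪ Q)` the zone `π⁻¹(Z₀ ∪ Z₂)` consists of the black quadrilateral vertices together with
all vertices off the quadrilateral (the form of the wired set required by
`rcMeasure_real_map_of_wired`). [folklore] -/
theorem mem_zone_iff {M Q : Set α} {B₀ B₂ : Set α}
    (hblack : ∀ v ∈ Z₀ ∪ Z₂, v ∈ Q → v ∈ B₀ ∪ B₂)
    (hoff : ∀ v, v ∈ M ∪ Q → v ∉ Z₀ ∪ Z₂ → v ∈ Q ∧ v ∉ B₀ ∪ B₂) (u : ↥(M ∪ Q)) :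
    u ∈ ({v : ↥(M ∪ Q) | v.1 ∈ Z₀} ∪ {v | v.1 ∈ Z₂}) ↔
      ∀ x : ↥Q, Set.embeddingOfSubset Q (M ∪ Q) Set.subset_union_right x = u →
        x ∈ ({x : ↥Q | x.1 ∈ B₀} ∪ {x | x.1 ∈ B₂}) := by
  constructor
  · rintro hu x rfl
    exact hblack x.1 hu x.2
  · intro H
    by_contra hu
    obtain ⟨huQ, hnb⟩ := hoff u.1 u.2 hu
    exact hnb (H ⟨u.1, huQ⟩ (Subtype.ext rfl))

end Zone

/-! #### The crossing probability of `Ω_δ` as a random-cluster probability of `domainSubgraph` -/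

open scoped Classical in
/-- Smirnov's crossing probability under `fkDomainMeasure` (wired on the discrete arc of
`(ab) ∪ (cd)`) is the `rcMeasure`-probability, for the graph `domainSubgraph R.carrier δ` wired on
`rectArc R δ 0 ∪ rectArc R δ 2`, of the intrinsic crossing event
`arcCrossing (rectArc R δ 0) (rectArc R δ 2)` (both are the same finite sum;
`rectArc_zero_union_two`, `mem_rectCrossing_iff`). [cite: Grimmett2006, §1.2 eq. (1.1)] -/
theorem real_fkDomainMeasure_discreteCrossing_eq (R : ConformalRectangle) {δ p q : ℝ}
    (hp : p ∈ Set.Icc (0 : ℝ) 1) (hq : 0 < q) [Fintype (meshDomain R.carrier δ)] :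
    (fkDomainMeasure R.carrier δ p q (R.arc 0 ∪ R.arc 2)).real
        (discreteCrossing R.carrier δ (R.arc 0) (R.arc 2)) =
      (rcMeasure (domainSubgraph R.carrier δ) p q (rectArc R δ 0 ∪ rectArc R δ 2)).real
        (arcCrossing (rectArc R δ 0) (rectArc R δ 2)) := by
  rw [measureReal_fkDomainMeasure _ _ hp hq, ← rectArc_zero_union_two,
    measureReal_rcMeasure _ hp hq]
  congr 1
  refine Finset.sum_congr (Finset.filter_congr fun ω hω => ?_) fun _ _ => rfl
  rw [← coe_mem_rectCrossing_iff]
  exact mem_rectCrossing_iff R fun e he => mem_edgeFinset.1 (Finset.mem_powerset.1 hω he)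

end UpperComparison

open UpperComparison

open scoped Classical in
/-- **Stub `stub_loopSymmetricLimit_upperComparison`** of the skeleton of the crux
`IsingJetsConformal` (stmt-CriticalPhenomena-5560, `n = 0` bridge, upper comparison): under the
zone hypotheses of the module docstring, the `fkDomainMeasure`-probability of Smirnov's crossing
event of the conformal rectangle `R` at mesh `δ` (wired on the discrete arcs of `(ab) ∪ (cd)`) is at
most the probability that the two black arcs `B₀`, `B₂` of the glued discrete quadrilateral `E` are
joined by an open crossing, under the random-cluster measure of `⟨E⟩` wired on `B₀ ∪ B₂`
(`0 ≤ p < 1`, `q ≥ 1`). Both sides are transported into the common vertex type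
`↥(meshDomain R.carrier δ ∪ verts E)` (`rcMeasure_real_map_image`, `rcMeasure_real_map_of_wired`,
Grimmett 2006, Lemma (4.13)) and compared there by `stub_loopSymmetricLimit_sandwichUpper`, whose
deterministic hypothesis is `stub_loopSymmetricLimit_pathUpper`.
[cite: Grimmett2006, Lemma (4.13)] -/
theorem stub_loopSymmetricLimit_upperComparison : (∀ (R : Literature.Probability.RandomPlanarGeometry.ConformalRectangle) (δ p q : ℝ), 0 < δ → p ∈ Set.Icc (0 : ℝ) 1 → p < 1 → 1 ≤ q → ∀ [Fintype (Literature.Probability.LatticeModels.meshDomain R.carrier δ)] (E : Finset (Sym2 (Literature.Probability.LatticeModels.Site 2))) (d₀ : Literature.Probability.LatticeModels.Site 2 × Fin 4) (n : Fin 4 → ℕ) [DecidableRel (Literature.Probability.LatticeModels.DiscreteRect.graph E).Adj] (Z₀ Z₂ : Set (Literature.Probability.LatticeModels.Site 2)), Disjoint Z₀ Z₂ → Literature.Probability.LatticeModels.discreteArc R.carrier δ (R.arc 0) ⊆ Z₀ → Literature.Probability.LatticeModels.discreteArc R.carrier δ (R.arc 2) ⊆ Z₂ → Literature.Probability.LatticeModels.DiscreteRect.blackVerts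 E d₀ n 0 ⊆ Z₀ → Literature.Probability.LatticeModels.DiscreteRect.blackVerts E d₀ n 2 ⊆ Z₂ → (∀ x ∈ Z₀, ∀ y ∈ Z₂, ¬ (Literature.Probability.LatticeModels.discreteDomainGraph R.carrier δ).Adj x y ∧ s(x, y) ∉ E) → (∀ v ∈ Z₀ ∪ Z₂, v ∈ (Literature.Probability.LatticeModels.DiscreteRect.verts E : Set (Literature.Probability.LatticeModels.Site 2)) → v ∈ Literature.Probability.LatticeModels.DiscreteRect.blackVerts E d₀ n 0 ∪ Literature.Probability.LatticeModels.DiscreteRect.blackVerts E d₀ n 2) → (∀ v, v ∈ Literature.Probability.LatticeModels.meshDomain R.carrier δ ∪ (Literature.Probability.LatticeModels.DiscreteRect.verts E : Set (Literature.Probability.LatticeModels.Site 2)) → v ∉ Z₀ ∪ Z₂ → v ∈ (Literature.Probability.LatticeModels.DiscreteRect.verts E : Set (Literature.Probability.LatticeModels.Site 2)) ∧ v ∉ Literature.Probability.LatticeModels.DiscreteRect.blackVerts E d₀ n 0 ∪ Literature.Probability.LatticeModels.DiscreteRect.blackVerts E d₀ n 2) → (∀ x y : Literature.Probability.LatticeModels.Site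 2, (Literature.Probability.LatticeModels.discreteDomainGraph R.carrier δ).Adj x y → s(x, y) ∉ E → x ∈ Z₀ ∪ Z₂) → (Literature.Probability.LatticeModels.fkDomainMeasure R.carrier δ p q (R.arc 0 ∪ R.arc 2)).real (Literature.Probability.Percolation.discreteCrossing R.carrier δ (R.arc 0) (R.arc 2)) ≤ (Literature.Probability.LatticeModels.rcMeasure (Literature.Probability.LatticeModels.DiscreteRect.graph E) p q ({x | x.1 ∈ Literature.Probability.LatticeModels.DiscreteRect.blackVerts E d₀ n 0} ∪ {x | x.1 ∈ Literature.Probability.LatticeModels.DiscreteRect.blackVerts E d₀ n 2})).real (Literature.Probability.LatticeModels.arcCrossing {x | x.1 ∈ Literature.Probability.LatticeModels.DiscreteRect.blackVerts E d₀ n 0} {x | x.1 ∈ Literature.Probability.LatticeModels.DiscreteRect.blackVerts E d₀ n 2})) := by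
  intro R δ p q hδ hp hp1 hq _ E d₀ n _ Z₀ Z₂ hdisj hW0 hW2 hB0 hB2 hfar hblack hoff hmiss
  have hq0 : 0 < q := one_pos.trans_le hq
  -- the two embeddings into the common vertex type `↥(meshDomain R.carrier δ ∪ verts E)`
  let jΩ := Set.embeddingOfSubset (meshDomain R.carrier δ)
    (meshDomain R.carrier δ ∪ ↑(DiscreteRect.verts E)) Set.subset_union_left
  let jE := Set.embeddingOfSubset (↑(DiscreteRect.verts E) : Set (Site 2))
    (meshDomain R.carrier δ ∪ ↑(DiscreteRect.verts E)) Set.subset_union_right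
  let EΩ := (domainSubgraph R.carrier δ).edgeFinset.map jΩ.sym2Map
  let EQ := (DiscreteRect.graph E).edgeFinset.map jE.sym2Map
  -- incidence in the common vertex type
  have fΩ : ∀ u w, s(u, w) ∈ EΩ → (discreteDomainGraph R.carrier δ).Adj u.1 w.1 := by
    intro u w h
    obtain ⟨a, b, hab, rfl, rfl⟩ := (mk_mem_map_iff jΩ _).1 h
    exact hab
  have fQ : ∀ u w, s(u, w) ∈ EQ → s(u.1, w.1) ∈ E := by
    intro u w h
    obtain ⟨a, b, hab, rfl, rfl⟩ := (mk_mem_map_iff jE _).1 h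
    have hab' : s(a.1, b.1) ∈ (↑E : Set (Sym2 (Site 2))) ∧ a.1 ≠ b.1 := hab
    exact hab'.1
  have fQ' : ∀ u w, (discreteDomainGraph R.carrier δ).Adj u.1 w.1 → s(u.1, w.1) ∈ E →
      s(u, w) ∈ EQ := by
    intro u w hD hE
    have hu : u.1 ∈ DiscreteRect.verts E := by
      rw [Sym2.eq_swap] at hE
      exact DiscreteRect.mem_verts_of_mem hE
    exact (mk_mem_map_iff jE _).2 ⟨⟨u.1, hu⟩, ⟨w.1, DiscreteRect.mem_verts_of_mem hE⟩,
      (fromEdgeSet_adj (↑E : Set (Sym2 (Site 2)))).2 ⟨hE, hD.ne⟩, Subtype.ext rfl,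
      Subtype.ext rfl⟩
  have hsymm : ∀ x y, (discreteDomainGraph R.carrier δ).Adj x y →
      (discreteDomainGraph R.carrier δ).Adj y x := fun x y h => h.symm
  -- zone vertices incident to `E`-edges are black
  have hC : ∀ Z Z' B B' : Set (Site 2), Disjoint Z Z' → B' ⊆ Z' →
      (∀ v ∈ Z ∪ Z', v ∈ (↑(DiscreteRect.verts E) : Set (Site 2)) → v ∈ B ∪ B') →
      ∀ v : ↥(meshDomain R.carrier δ ∪ ↑(DiscreteRect.verts E)), v.1 ∈ Z → ∀ e ∈ EQ, v ∈ e →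
        v ∈ jE '' {x | x.1 ∈ B} := by
    intro Z Z' B B' hdj hB' hbl v hv e he hve
    obtain ⟨c, rfl⟩ := exists_apply_eq_of_mem_map jE _ he hve
    have hc : c.1 ∈ Z := hv
    exact ⟨c, mem_black_of_mem_zone hdj hB' hbl hc c.2, rfl⟩
  -- Step 1: the left-hand side as a random-cluster probability in the common vertex type
  have h1 := real_fkDomainMeasure_discreteCrossing_eq R hp hq0 (δ := δ)
  have h2 := rcMeasure_real_arcCrossing_map_image jΩ hp hq0 (rectArc R δ 0 ∪ rectArc R δ 2)
    (rectArc R δ 0) (rectArc R δ 2) (K := domainSubgraph R.carrier δ)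
  -- Step 2: the sandwich inside the common vertex type
  have h3 : (rcMeasure (fromEdgeSet (↑EΩ : Set _)) p q
        (jΩ '' (rectArc R δ 0 ∪ rectArc R δ 2))).real
        (arcCrossing (jΩ '' rectArc R δ 0) (jΩ '' rectArc R δ 2)) ≤
      (rcMeasure (fromEdgeSet (↑EQ : Set _)) p q ({v | v.1 ∈ Z₀} ∪ {v | v.1 ∈ Z₂})).real
        (arcCrossing (jE '' {x | x.1 ∈ DiscreteRect.blackVerts E d₀ n 0})
          (jE '' {x | x.1 ∈ DiscreteRect.blackVerts E d₀ n 2})) := by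
    refine stub_loopSymmetricLimit_sandwichUpper _ (fromEdgeSet (↑(EΩ ∪ EQ) : Set _)) p q hp hp1
      hq EΩ EQ (fun e he => ?_) (fun e he => ?_) _ _ ?_ (fun e he heQ => ?_) _ _
      (isUpperSet_arcCrossing _ _) ?_
    · rw [mem_edgeFinset_iff, edgeSet_fromEdgeSet]
      exact ⟨Finset.mem_union_left _ he, not_isDiag_of_mem_map jΩ _ he⟩
    · rw [mem_edgeFinset_iff, edgeSet_fromEdgeSet]
      exact ⟨Finset.mem_union_right _ he, not_isDiag_of_mem_map jE _ he⟩
    · rintro _ ⟨x, hx, rfl⟩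
      rcases hx with h | h
      · exact Or.inl (hW0 h)
      · exact Or.inr (hW2 h)
    · exact mem_zone_of_mem_edgeSet Subtype.val fΩ hsymm fQ' hmiss e (mem_edgeFinset_iff.1 he)
        heQ
    · exact inter_mem_arcCrossing Subtype.val fΩ fQ hsymm fQ' hfar hmiss hdisj
        (by rintro _ ⟨x, hx, rfl⟩; exact hW0 hx) (by rintro _ ⟨x, hx, rfl⟩; exact hW2 hx)
        (hC _ _ _ _ hdisj hB2 hblack)
        (hC _ _ _ _ hdisj.symm hB0 fun v hv hvE => (hblack v hv.symm hvE).symm)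
  -- Step 3: back to the quadrilateral `⟨E⟩` on its own vertex type
  have h4 : (rcMeasure (fromEdgeSet (↑EQ : Set _)) p q ({v | v.1 ∈ Z₀} ∪ {v | v.1 ∈ Z₂})).real
        (arcCrossing (jE '' {x | x.1 ∈ DiscreteRect.blackVerts E d₀ n 0})
          (jE '' {x | x.1 ∈ DiscreteRect.blackVerts E d₀ n 2})) ≤
      (rcMeasure (DiscreteRect.graph E) p q
        ({x | x.1 ∈ DiscreteRect.blackVerts E d₀ n 0} ∪
          {x | x.1 ∈ DiscreteRect.blackVerts E d₀ n 2})).real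
        (arcCrossing {x | x.1 ∈ DiscreteRect.blackVerts E d₀ n 0}
          {x | x.1 ∈ DiscreteRect.blackVerts E d₀ n 2}) := by
    by_cases hne : ({x : ↥(↑(DiscreteRect.verts E) : Set (Site 2)) |
        x.1 ∈ DiscreteRect.blackVerts E d₀ n 0} ∪
        {x | x.1 ∈ DiscreteRect.blackVerts E d₀ n 2}).Nonempty
    · exact (rcMeasure_real_arcCrossing_map_of_wired jE hp hq0 hne (mem_zone_iff hblack hoff)
        _ _).le
    · have h0 : arcCrossing (jE '' {x | x.1 ∈ DiscreteRect.blackVerts E d₀ n 0})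
          (jE '' {x | x.1 ∈ DiscreteRect.blackVerts E d₀ n 2}) = ∅ :=
        Set.subset_empty_iff.1 fun ω ⟨_, ⟨c, hc, _⟩, _⟩ => hne ⟨c, Or.inl hc⟩
      rw [h0, measureReal_empty]
      exact measureReal_nonneg
  exact (h1.trans h2.symm).trans_le (h3.trans h4)

end

end Summit.CriticalPhenomena.CardyFormulaZ2.Theorems.CardyQContinuation
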